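import Mathlib

/-!
# Frame cap for unequal frames, `r ≤ C(a + b, a)` — elementary proof by block determinants

Item `stmt-MatrixMultiplication-14308` (`FourierTwoFamiliesModP.PrimeTwoFamilies`), line Sketch.
The line's ZONE THEOREM `LadderLift.frameCap` (file `…PrimeTwoFamiliesFrameCap.lean`, exterior
algebra proof) caps COMPLEMENTARY `l + l` frames in `F^{2l}` at `C(2l, l)` classes.  This support
file proves the general exact-dimension case of Lovász's (1977) skew Bollobás theorem for
subspaces — `dim V = a`, `dim W = b`, `dim E = a + b`, bound `C(a + b, a)` — by an explicit,
elementary argument (determinants of a basis, currying, sorting; no exterior powers), together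
with the reusable extensionality principle it rests on: an alternating `k`-form is determined by
its values on SORTED `k`-tuples of basis vectors.  The tree's `frameCap` is the case `a = b = l`,
`E = F^{2l}` (not re-declared here).

## Proof of `frameCap_of_finrank_eq_add`

Fix a basis `e` of `E` indexed by `Fin a ⊕ Fin b` and basis families `u c : Fin a → E` of `V c`,
`w c : Fin b → E` of `W c`.  The BLOCK DETERMINANT `M p q := det_e (u p ; w q)` satisfies

* `M c c ≠ 0`: `u c ; w c` is independent (`V c ⊓ W c = ⊥`) of full cardinality, so a basis;
* `M p q = 0` for `p < q`: a nonzero determinant would make `u p ; w q` span `E`, i.e.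
  `V p ⊔ W q = ⊤`.

So `M` is lower triangular with nonzero diagonal.  For weights `c : Fin r → F` the map
`G_c : x ↦ ∑ j, c j * det_e (x ; w j)` is an alternating `a`-form on `E`, hence determined by its
values on sorted tuples `(s i₁, …, s i_a)`, `i₁ < ⋯ < i_a`, of a basis `s` indexed by
`Fin (a + b)` (`alternatingMap_ext_of_sorted`).  So the vectors `φ j := (det_e (s_S ; w j))_S`
indexed by the `a`-subsets `S` — the complementary maximal minors of `w j` — control everything:
a relation `∑ j, c j • φ j = 0` forces `G_c = 0`, so `∑ j, c j * M i j = G_c (u i) = 0` for every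
row `i`, and back substitution gives `c = 0`.  Thus `φ` is an independent family of `r` vectors
in `F^{C(a+b, a)}`, and `r ≤ C(a + b, a)`.
-/

-- single-conjunct summit: the mandated namespace repeats `MatrixMultiplication` (summit = sub-problem).
set_option linter.dupNamespace false

namespace Summit.MatrixMultiplication.MatrixMultiplication.Theorems.PrimeTwoFamilies.FrameCapMinors

open Module

section SortedExt

variable {R : Type*} [CommRing R] {M : Type*} [AddCommGroup M] [Module R M]
  {N : Type*} [AddCommGroup N] [Module R N]

/-- SORTED EXTENSIONALITY for alternating maps: two alternating `k`-forms on a module with a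
basis `s` indexed by a linear order agree as soon as they agree on every SORTED `k`-tuple
`(s i₁, …, s i_k)`, `i₁ < ⋯ < i_k` (sharpening `Module.Basis.ext_alternating`, which asks for all
injective tuples: sort an injective tuple by a permutation and use `AlternatingMap.map_perm`). -/
theorem alternatingMap_ext_of_sorted {ι : Type*} [LinearOrder ι] {k : ℕ} (s : Basis ι R M)
    {f g : M [⋀^Fin k]→ₗ[R] N}
    (h : ∀ (S : Finset ι) (hS : S.card = k),
      f (⇑s ∘ ⇑(S.orderEmbOfFin hS)) = g (⇑s ∘ ⇑(S.orderEmbOfFin hS))) :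
    f = g := by
  refine Module.Basis.ext_alternating s fun v hv => ?_
  -- sort the injective tuple `v` by a permutation `σ`
  set σ : Equiv.Perm (Fin k) := Tuple.sort v with hσ
  have hsm : StrictMono (v ∘ ⇑σ) :=
    (Tuple.monotone_sort v).strictMono_of_injective (hv.comp σ.injective)
  set S : Finset ι := Finset.univ.image v with hSdef
  have hS : S.card = k := by
    rw [hSdef, Finset.card_image_of_injective _ hv, Finset.card_univ, Fintype.card_fin]
  have hw : v ∘ ⇑σ = ⇑(S.orderEmbOfFin hS) :=
    Finset.orderEmbOfFin_unique hS (fun x => Finset.mem_image_of_mem v (Finset.mem_univ _)) hsm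
  have hpt : ∀ x, v (σ x) = S.orderEmbOfFin hS x := fun x => congrFun hw x
  have hv' : (fun i => s (v i)) = (⇑s ∘ ⇑(S.orderEmbOfFin hS)) ∘ ⇑σ.symm := by
    funext i
    show s (v i) = s (S.orderEmbOfFin hS (σ.symm i))
    rw [← hpt, Equiv.apply_symm_apply]
  rw [hv', f.map_perm, g.map_perm, h S hS]

/-- An alternating `k`-form that vanishes on every sorted `k`-tuple of vectors of a basis indexed
by a linear order vanishes identically. -/
theorem alternatingMap_eq_zero_of_sorted {ι : Type*} [LinearOrder ι] {k : ℕ} (s : Basis ι R M)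
    {f : M [⋀^Fin k]→ₗ[R] N}
    (h : ∀ (S : Finset ι) (hS : S.card = k), f (⇑s ∘ ⇑(S.orderEmbOfFin hS)) = 0) : f = 0 :=
  alternatingMap_ext_of_sorted s fun S hS => by rw [h S hS, AlternatingMap.zero_apply]

end SortedExt

section Elementary

variable {F : Type*} [Field F] {E : Type*} [AddCommGroup E] [Module F E]

/-- Back substitution: if `∑ j, c j * M i j = 0` for every row `i` of a lower-triangular matrix
`M` (`M i j = 0` for `i < j`) with nonzero diagonal, then `c = 0`. -/
private theorem eq_zero_of_lowerTriangular {r : ℕ} (M : Fin r → Fin r → F) (c : Fin r → F)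
    (hdiag : ∀ i, M i i ≠ 0) (hupper : ∀ i j, i < j → M i j = 0)
    (h : ∀ i, ∑ j, c j * M i j = 0) : c = 0 := by
  classical
  by_contra hne
  obtain ⟨j₀, hj₀⟩ : ∃ j, c j ≠ 0 := by
    by_contra! h0
    exact hne (funext h0)
  obtain ⟨j, hj, hmin⟩ := Finset.exists_min_image (Finset.univ.filter fun p => c p ≠ 0)
    (fun p => p) ⟨j₀, by simpa using hj₀⟩
  simp only [Finset.mem_filter, Finset.mem_univ, true_and] at hj hmin
  have hsum : ∑ p, c p * M j p = c j * M j j := by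
    refine Finset.sum_eq_single j (fun p _ hpj => ?_) (by simp)
    rcases lt_or_gt_of_ne hpj with hlt | hgt
    · have hp : c p = 0 := not_not.1 fun hp => (not_le.2 hlt) (hmin p hp)
      rw [hp, zero_mul]
    · rw [hupper j p hgt, mul_zero]
  have hrow := h j
  rw [hsum] at hrow
  exact mul_ne_zero hj (hdiag j) hrow

/-- The WEIGHTED BLOCK-DETERMINANT FORM `x ↦ ∑ j, c j * det_e (x ; w j)` is an alternating
`a`-form on `E` (for a basis `e` of `E` indexed by `Fin a ⊕ Fin b` and blocks `w j : Fin b → E`):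
it is the weighted evaluation `m ↦ ∑ j, c j * m (w j)` of the curried determinant, and two equal
arguments are two equal rows. -/
private theorem exists_weightedBlockDet {a b r : ℕ} (e : Basis (Fin a ⊕ Fin b) F E)
    (w : Fin r → Fin b → E) (c : Fin r → F) :
    ∃ G : E [⋀^Fin a]→ₗ[F] F, ∀ x, G x = ∑ j, c j * e.det (Sum.elim x (w j)) :=
  ⟨{ (({ toFun := fun m => ∑ j, c j * m (w j),
           map_add' := fun m m' => by
             simp only [add_apply, mul_add, Finset.sum_add_distrib],
           map_smul' := fun t m => by
             simp only [smul_apply, smul_eq_mul, RingHom.id_apply, Finset.mul_sum,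
               mul_left_comm] } :
          MultilinearMap F (fun _ : Fin b => E) F →ₗ[F] F).compMultilinearMap
        (MultilinearMap.currySum (e.det : E [⋀^(Fin a ⊕ Fin b)]→ₗ[F] F).toMultilinearMap)) with
      map_eq_zero_of_eq' := fun x i j h hij => by
        change ∑ k, c k * e.det (Sum.elim x (w k)) = 0
        refine Finset.sum_eq_zero fun k _ => ?_
        rw [e.det.map_eq_zero_of_eq (Sum.elim x (w k)) (i := Sum.inl i) (j := Sum.inl j)
          (by simpa using h) (by simpa using hij), mul_zero] },
    fun _ => rfl⟩

/-- FRAME CAP FOR UNEQUAL FRAMES (Lovász 1977, skew Bollobás for subspaces, exact-dimension case;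
elementary proof by block determinants and sorted minors): in a space `E` of dimension `a + b`,
a family of pairs `(V c, W c)` with `dim V c = a`, `dim W c = b`, complementary on the diagonal
(`V c ⊓ W c = ⊥`) and non-spanning on lower cross pairs (`V p ⊔ W q ≠ ⊤` for `p < q`) has at
most `Nat.choose (a + b) a` members.  The tree's `LadderLift.frameCap` is the case `a = b = l`,
`E = Fin (2 * l) → F`. -/
theorem frameCap_of_finrank_eq_add {F : Type*} [Field F] {E : Type*} [AddCommGroup E]
    [Module F E] [FiniteDimensional F E] {a b r : ℕ} (hE : Module.finrank F E = a + b)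
    (V W : Fin r → Submodule F E)
    (hdimV : ∀ c, Module.finrank F (V c) = a) (hdimW : ∀ c, Module.finrank F (W c) = b)
    (hdiag : ∀ c, V c ⊓ W c = ⊥) (hcross : ∀ p q : Fin r, p < q → V p ⊔ W q ≠ ⊤) :
    r ≤ (a + b).choose a := by
  classical
  -- an ordered basis `s` (for sorting) and its block-indexed copy `e` (for block determinants)
  let s : Basis (Fin (a + b)) F E := Module.finBasisOfFinrankEq F E hE
  let e : Basis (Fin a ⊕ Fin b) F E := s.reindex finSumFinEquiv.symm
  -- (0) basis families of the `V c` and the `W c`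
  have hbasis : ∀ (U : Submodule F E) (d : ℕ), Module.finrank F U = d →
      ∃ u : Fin d → E, LinearIndependent F u ∧ Submodule.span F (Set.range u) = U :=
    fun U d hU => by
    let bU := Module.finBasisOfFinrankEq F U hU
    refine ⟨U.subtype ∘ ⇑bU, bU.linearIndependent.map' _ (Submodule.ker_subtype _), ?_⟩
    rw [Set.range_comp, Submodule.span_image, bU.span_eq, Submodule.map_top,
      Submodule.range_subtype]
  choose u huli huspan using fun c => hbasis (V c) a (hdimV c)
  choose w hwli hwspan using fun c => hbasis (W c) b (hdimW c)
  -- (1) the block determinant `det_e (u p ; w q)` is lower triangular with nonzero diagonal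
  have hMdiag : ∀ c, e.det (Sum.elim (u c) (w c)) ≠ 0 := fun c => by
    have hli : LinearIndependent F (Sum.elim (u c) (w c)) :=
      (huli c).sum_type (hwli c) (by rw [huspan, hwspan]; exact disjoint_iff.2 (hdiag c))
    have hcard : Fintype.card (Fin a ⊕ Fin b) = Module.finrank F E := by
      rw [Fintype.card_sum, Fintype.card_fin, Fintype.card_fin, hE]
    exact ((Module.Basis.is_basis_iff_det e).1
      ⟨hli, hli.span_eq_top_of_card_eq_finrank' hcard⟩).ne_zero
  have hMupper : ∀ p q, p < q → e.det (Sum.elim (u p) (w q)) = 0 := fun p q hpq => by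
    by_contra hne
    have hsp := ((Module.Basis.is_basis_iff_det e).2 (isUnit_iff_ne_zero.2 hne)).2
    rw [Set.Sum.elim_range, Submodule.span_union, huspan, hwspan] at hsp
    exact hcross p q hpq hsp
  -- (2) sorted complementary minors: one coordinate per `a`-subset `S` of `Fin (a + b)`
  have hTcard : ∀ S : ↥(Finset.powersetCard a (Finset.univ : Finset (Fin (a + b)))),
      (S : Finset (Fin (a + b))).card = a := fun S => (Finset.mem_powersetCard.1 S.2).2
  let φ : Fin r → ↥(Finset.powersetCard a (Finset.univ : Finset (Fin (a + b)))) → F :=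
    fun j S => e.det (Sum.elim (⇑s ∘ ⇑((S : Finset (Fin (a + b))).orderEmbOfFin (hTcard S))) (w j))
  -- (3) the minor vectors `φ j` are linearly independent
  have hφ : LinearIndependent F φ := by
    rw [Fintype.linearIndependent_iff]
    intro c hc
    -- the weighted form `G_c` vanishes on sorted tuples of `s`, hence everywhere
    obtain ⟨G, hGx⟩ := exists_weightedBlockDet e w c
    have hG : G = 0 := by
      refine alternatingMap_eq_zero_of_sorted s fun S hS => ?_
      have hmem : S ∈ Finset.powersetCard a (Finset.univ : Finset (Fin (a + b))) :=
        Finset.mem_powersetCard.2 ⟨Finset.subset_univ _, hS⟩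
      have h0 := congrFun hc ⟨S, hmem⟩
      rw [Finset.sum_apply] at h0
      simpa only [φ, Pi.smul_apply, smul_eq_mul, Pi.zero_apply, hGx] using h0
    -- rows: `∑ j, c j * det_e (u i ; w j) = G_c (u i) = 0`
    have hrow : ∀ i, ∑ j, c j * e.det (Sum.elim (u i) (w j)) = 0 := fun i => by
      have h0 := DFunLike.congr_fun hG (u i)
      rwa [hGx, AlternatingMap.zero_apply] at h0
    have h0 := eq_zero_of_lowerTriangular (fun i j => e.det (Sum.elim (u i) (w j))) c
      hMdiag hMupper hrow
    exact fun j => congrFun h0 j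
  -- (4) count: `r` independent vectors in `F^{C(a + b, a)}`
  have h := hφ.fintype_card_le_finrank
  rwa [Fintype.card_fin, Module.finrank_fintype_fun_eq_card, Fintype.card_coe,
    Finset.card_powersetCard, Finset.card_univ, Fintype.card_fin] at h

end Elementary

end Summit.MatrixMultiplication.MatrixMultiplication.Theorems.PrimeTwoFamilies.FrameCapMinors
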